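import Literature.NumberTheory.Transcendental.HeightLocalGlobal
import HarnessLib

/-!
# Heights of roots of weighted integral relations: `w·h(α) ≤ u·h(β) + O([K:ℚ])`

A sharp ("weighted") form of the classical bound for the height of a root of a monic polynomial
whose coefficients are themselves polynomials in a second algebraic number. Let
`a₀, …, a_{N-1} ∈ ℤ[X]` and suppose the weights `u, w ≥ 1` satisfy

  `w · deg a_k ≤ u · (N - k)`  for all `k < N`

(i.e. the relation `Y^N + Σ_{k<N} a_k(X) Y^k` only involves monomials `X^i Y^k` with
`w i + u k ≤ u N`: it is dominated by the weighted-homogeneous form of weight `uN` for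
`wt X = w`, `wt Y = u`). Then for every field `K` with an admissible family of absolute values and
all `α, β ∈ K` with `α^N + Σ_{k<N} a_k(β) α^k = 0`:

  `w · logHeight₁ α ≤ u · logHeight₁ β + totalWeight K · w · log (N · B)`,

`B = max(1, Σ_k ‖a_k‖₁)` (`mulHeight₁_pow_le_of_weighted`, `logHeight₁_le_of_weighted`); for a
number field `totalWeight K = [K:ℚ]`, so in terms of ABSOLUTE heights `h = logHeight₁/[K:ℚ]` the
constant is uniform in the field: `w·h(α) ≤ u·h(β) + w·log(NB)`. The version with a nonzero integer
leading coefficient `c` (`c·α^N + …`) is `logHeight₁_le_of_weighted_leadingCoeff`.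

The point of the weights: the crude bound (`h(α) ≤ Σ_k h(a_k(β)) + log N`, e.g.
`Literature.NumberTheory.Transcendental.RoyWaldschmidt1997.logHeight₁_root_le_of_monic`, or the
`m·D_X` of Nesterenko–Philippon Ch. 2 Lemma 2.8) loses the factor that geometry predicts. If `α`
and `β` are two functions on a curve with a single common pole (orders `e_α`, `e_β`), the minimal
polynomial of `α` over `ℚ(β)` has exactly the weighted shape above with `u/w = e_α/e_β`, and the
theorem gives the Weil-height comparison `h(α(P)) ≤ (e_α/e_β)·h(β(P)) + O(1)` with the SHARP slope
(the lower bound with the same slope is in `WeightedRootHeightLower.lean`). This is the elementary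
substitute for the Néron/Weil height machine used by the abc-iut cell for the explicit curves of
[GenEll] §2 (S. Mochizuki, *Arithmetic elliptic curves in general position*, Math. J. Okayama Univ.
52 (2010); cell route `Summit.ABC.ABC.Theses.IUTThetaPilot.GenEllTwo`, work package W4 of the
number-field-only plan): e.g. `r^e = x(1-x)` gives `|e·h(r) − 2·h(x)| = O(1)`.

Proof: at each absolute value `v`, with `t = v α`, `M = max(v β, 1)`, the relation gives
`t^N ≤ Σ_k B M^{deg a_k} t^k` (archimedean) resp. `t^N ≤ max_k M^{deg a_k} t^k` (non-archimedean),
whence `t^w ≤ (NB)^w M^u` resp. `t^w ≤ M^u` by the weight condition (`pow_le_of_weighted_sum`,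
`pow_le_of_weighted_term`); then the tree's local-to-global principle
`Literature.NumberTheory.Transcendental.mulHeight₁_le_of_forall_absValue_le` applied to `α^w`.
Everything here is proved; no definitions, no named facts. Source: this is the affine two-variable,
general-weight form of the setup of Bombieri–Gubler, *Heights in Diophantine Geometry* (CUP 2006),
§2.5 "Explicit bounds for Weil heights": an element `z_{r+1}` integral over `ℚ̄[z_0,…,z_r]` whose
minimal polynomial (2.5) `f_0 + f_1 z + ⋯ + z^d` has `f_i` homogeneous of degree `d - i`, and the
resulting place-by-place bounds (2.7)–(2.9) (read on the held copy, p. 43) [cite: BombieriGubler2006,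
§2.5 (2.5)–(2.9) p.43]; the unweighted root bound is Nesterenko–Philippon LNM 1752 Ch. 2 Lemma 2.8
(tree: `RoyWaldschmidt1997.logHeight₁_root_le_of_monic`). Nothing in this file refers to the
disputed parts of the abc-iut corpus.
-/

noncomputable section

open Height Height.AdmissibleAbsValues Finset Polynomial Real
open Literature.NumberTheory.Transcendental

namespace Literature.NumberTheory.DiophantineGeometry

namespace WeightedRoot

/-! ### The real-number core: weighted domination -/

/-- **Weighted domination, sum form.** If `t ≥ 0`, `M, B ≥ 1`, `0 < N`, `0 < w`, the exponents
satisfy `w·d_k ≤ u·(N-k)` for `k < N`, and `t^N ≤ Σ_{k<N} B·M^{d_k}·t^k`, then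
`t^w ≤ (N·B)^w · M^u`. [folklore] -/
private theorem pow_le_of_weighted_sum {t M B : ℝ} {N u w : ℕ} {d : ℕ → ℕ} (ht : 0 ≤ t) (hM : 1 ≤ M)
    (hB : 1 ≤ B) (hN : 0 < N) (hw : 0 < w) (hd : ∀ k < N, w * d k ≤ u * (N - k))
    (hrel : t ^ N ≤ ∑ k ∈ range N, B * M ^ d k * t ^ k) :
    t ^ w ≤ (N * B) ^ w * M ^ u := by
  by_contra hcon
  push Not at hcon
  have hNB : (1 : ℝ) ≤ N * B := by
    have : (1 : ℝ) ≤ N := by exact_mod_cast hN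
    nlinarith
  have hMu : (1 : ℝ) ≤ M ^ u := one_le_pow₀ hM
  have hNBw : 0 < ((N : ℝ) * B) ^ w := by positivity
  -- `M^u < t^w / (NB)^w`
  have hlt : M ^ u < t ^ w / (N * B) ^ w := by
    rw [lt_div_iff₀ hNBw]; linarith
  have htw : 0 < t ^ w := lt_of_le_of_lt (by positivity) hcon
  have ht0 : 0 < t := by
    rcases ht.lt_or_eq with h | h
    · exact h
    · rw [← h, zero_pow hw.ne'] at htw; exact absurd htw (lt_irrefl _)
  -- each term is `< t^N / N`
  have hterm : ∀ k ∈ range N, B * M ^ d k * t ^ k < t ^ N / N := by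
    intro k hk
    have hkN : k < N := mem_range.mp hk
    have hNk : 1 ≤ N - k := by omega
    -- compare `w`-th powers
    have h1 : (B * M ^ d k * t ^ k) ^ w ≤ B ^ w * (M ^ u) ^ (N - k) * t ^ (w * k) := by
      rw [mul_pow, mul_pow, ← pow_mul, ← pow_mul, ← pow_mul]
      have : M ^ (d k * w) ≤ M ^ (u * (N - k)) :=
        pow_le_pow_right₀ hM (by rw [mul_comm]; exact hd k hkN)
      have hB' : 0 ≤ B ^ w := by positivity
      have ht' : 0 ≤ t ^ (k * w) := by positivity
      rw [mul_comm w k]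
      gcongr
    have h2 : B ^ w * (M ^ u) ^ (N - k) * t ^ (w * k) <
        B ^ w * (t ^ w / (N * B) ^ w) ^ (N - k) * t ^ (w * k) := by
      have hBw : 0 < B ^ w := by positivity
      have htwk : 0 < t ^ (w * k) := by positivity
      have : (M ^ u) ^ (N - k) < (t ^ w / (N * B) ^ w) ^ (N - k) :=
        pow_lt_pow_left₀ hlt (by positivity) (by omega)
      nlinarith [mul_pos hBw htwk]
    have h3 : B ^ w * (t ^ w / (N * B) ^ w) ^ (N - k) * t ^ (w * k) ≤ (t ^ N / N) ^ w := by
      -- `(NB)^{w(N-k)} ≥ (NB)^w`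
      set X : ℝ := ((N : ℝ) * B) ^ w with hX
      have hX1 : 1 ≤ X := one_le_pow₀ hNB
      have hXpos : 0 < X := by positivity
      have hden : X ≤ X ^ (N - k) := le_self_pow₀ hX1 (by omega)
      have hexp : t ^ (w * (N - k)) * t ^ (w * k) = t ^ (N * w) := by
        rw [← pow_add]; congr 1
        calc w * (N - k) + w * k = w * (N - k + k) := by ring
          _ = N * w := by rw [Nat.sub_add_cancel hkN.le, mul_comm]
      have hBw : (0 : ℝ) < B ^ w := by positivity
      calc B ^ w * (t ^ w / X) ^ (N - k) * t ^ (w * k)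
          = B ^ w * (t ^ (w * (N - k)) * t ^ (w * k)) / X ^ (N - k) := by
            rw [div_pow, ← pow_mul]; ring
        _ = B ^ w * t ^ (N * w) / X ^ (N - k) := by rw [hexp]
        _ ≤ B ^ w * t ^ (N * w) / X :=
            div_le_div_of_nonneg_left (by positivity) hXpos hden
        _ = (t ^ N / N) ^ w := by
            rw [hX, mul_pow, div_pow, ← pow_mul]
            field_simp
    have h4 : (B * M ^ d k * t ^ k) ^ w < (t ^ N / N) ^ w := lt_of_le_of_lt h1 (h2.trans_le h3)
    exact lt_of_pow_lt_pow_left₀ w (by positivity) h4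
  have hsum : ∑ k ∈ range N, B * M ^ d k * t ^ k < ∑ _k ∈ range N, t ^ N / N :=
    sum_lt_sum_of_nonempty (nonempty_range_iff.mpr hN.ne') hterm
  rw [sum_const, card_range, nsmul_eq_mul, mul_div_cancel₀ _ (by exact_mod_cast hN.ne')] at hsum
  exact absurd (hrel.trans_lt hsum) (lt_irrefl _)

/-- **Weighted domination, max form** (for ultrametric absolute values). If `t ≥ 0`, `M ≥ 1`,
`0 < N`, `0 < w`, `w·d_k ≤ u·(N-k)` for `k < N`, and `t^N ≤ M^{d_k}·t^k` for SOME `k < N`, then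
`t^w ≤ M^u`. [folklore] -/
private theorem pow_le_of_weighted_term {t M : ℝ} {N u w : ℕ} {d : ℕ → ℕ} (ht : 0 ≤ t) (hM : 1 ≤ M)
    (hw : 0 < w) (hd : ∀ k < N, w * d k ≤ u * (N - k)) {k : ℕ} (hk : k < N)
    (hrel : t ^ N ≤ M ^ d k * t ^ k) : t ^ w ≤ M ^ u := by
  by_contra hcon
  push Not at hcon
  have hMu : (1 : ℝ) ≤ M ^ u := one_le_pow₀ hM
  have htw : 0 < t ^ w := lt_of_le_of_lt (by positivity) hcon
  have ht0 : 0 < t := by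
    rcases ht.lt_or_eq with h | h
    · exact h
    · rw [← h, zero_pow hw.ne'] at htw; exact absurd htw (lt_irrefl _)
  have hNk : 1 ≤ N - k := by omega
  have h1 : (M ^ d k * t ^ k) ^ w ≤ (M ^ u) ^ (N - k) * t ^ (w * k) := by
    rw [mul_pow, ← pow_mul, ← pow_mul, ← pow_mul]
    have : M ^ (d k * w) ≤ M ^ (u * (N - k)) :=
      pow_le_pow_right₀ hM (by rw [mul_comm]; exact hd k hk)
    have ht' : 0 ≤ t ^ (k * w) := by positivity
    rw [mul_comm w k]
    gcongr
  have h2 : (M ^ u) ^ (N - k) * t ^ (w * k) < (t ^ w) ^ (N - k) * t ^ (w * k) := by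
    have htwk : 0 < t ^ (w * k) := by positivity
    have : (M ^ u) ^ (N - k) < (t ^ w) ^ (N - k) := pow_lt_pow_left₀ hcon (by positivity) (by omega)
    nlinarith
  have h3 : (t ^ w) ^ (N - k) * t ^ (w * k) = (t ^ N) ^ w := by
    rw [← pow_mul, ← pow_mul, ← pow_add]; congr 1
    calc w * (N - k) + w * k = w * (N - k + k) := by ring
      _ = N * w := by rw [Nat.sub_add_cancel hk.le, mul_comm]
  have h4 : (M ^ d k * t ^ k) ^ w < (t ^ N) ^ w := by rw [← h3]; exact lt_of_le_of_lt h1 h2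
  have h5 : M ^ d k * t ^ k < t ^ N := lt_of_pow_lt_pow_left₀ w (by positivity) h4
  exact absurd (hrel.trans_lt h5) (lt_irrefl _)

/-! ### The `ℓ¹`-norm of an integer polynomial and the local evaluation bounds -/

/-- The `ℓ¹`-norm `Σ_i |a_i|` of an integer polynomial (sum over `i ≤ natDegree`). [folklore] -/
private theorem l1norm_nonneg (p : ℤ[X]) : 0 ≤ ∑ i ∈ range (p.natDegree + 1), |(p.coeff i : ℝ)| :=
  sum_nonneg fun _ _ => abs_nonneg _

variable {K : Type*} [Field K]

/-- The value of an integer polynomial as a sum: `aeval β p = Σ_{i ≤ deg p} p_i β^i`. [folklore] -/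
private theorem aeval_intPoly_eq_sum (p : ℤ[X]) (β : K) :
    aeval β p = ∑ i ∈ range (p.natDegree + 1), (p.coeff i : K) * β ^ i := by
  rw [aeval_eq_sum_range]
  refine sum_congr rfl fun i _ => ?_
  rw [zsmul_eq_mul]

/-- **Local evaluation bound** (archimedean type): `v(p(β)) ≤ ‖p‖₁ · max(v β, 1)^{deg p}` for an
integer polynomial `p` and any absolute value `v`. [folklore] -/
private theorem absValue_aeval_intPoly_le (v : AbsoluteValue K ℝ) (p : ℤ[X]) (β : K) :
    v (aeval β p) ≤ (∑ i ∈ range (p.natDegree + 1), |(p.coeff i : ℝ)|) * max (v β) 1 ^ p.natDegree := by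
  rw [aeval_intPoly_eq_sum, sum_mul]
  refine (v.sum_le _ _).trans (sum_le_sum fun i hi => ?_)
  rw [map_mul, map_pow]
  have h1 := absValue_intCast_le v (p.coeff i)
  have h2 : v β ^ i ≤ max (v β) 1 ^ p.natDegree :=
    (pow_le_pow_left₀ (v.nonneg β) (le_max_left _ _) i).trans
      (pow_le_pow_right₀ (le_max_right _ _) (Nat.lt_succ_iff.mp (mem_range.mp hi)))
  have := v.nonneg (p.coeff i : K)
  have := pow_nonneg (v.nonneg β) i
  gcongr

/-- **Local evaluation bound** (non-archimedean type): `v(p(β)) ≤ max(v β, 1)^{deg p}` for an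
integer polynomial `p` and a non-archimedean absolute value `v`. [folklore] -/
private theorem absValue_aeval_intPoly_le_of_isNonarchimedean {v : AbsoluteValue K ℝ}
    (hv : IsNonarchimedean v) (p : ℤ[X]) (β : K) :
    v (aeval β p) ≤ max (v β) 1 ^ p.natDegree := by
  rw [aeval_intPoly_eq_sum]
  have hne : (range (p.natDegree + 1)).Nonempty := nonempty_range_add_one
  refine (hv.apply_sum_le_sup hne).trans (sup'_le hne _ fun i hi => ?_)
  rw [map_mul, map_pow]
  have h1 : v (p.coeff i : K) ≤ 1 := hv.apply_intCast_le_one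
  have h2 : v β ^ i ≤ max (v β) 1 ^ p.natDegree :=
    (pow_le_pow_left₀ (v.nonneg β) (le_max_left _ _) i).trans
      (pow_le_pow_right₀ (le_max_right _ _) (Nat.lt_succ_iff.mp (mem_range.mp hi)))
  have := v.nonneg (p.coeff i : K)
  have := pow_nonneg (v.nonneg β) i
  calc v (p.coeff i : K) * v β ^ i ≤ 1 * max (v β) 1 ^ p.natDegree := by gcongr
    _ = _ := one_mul _

/-! ### Local bounds for a root of a weighted relation -/

/-- **Local weighted root bound** (archimedean type). If `α^N + Σ_{k<N} a_k(β) α^k = 0` with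
`a_k ∈ ℤ[X]`, `w·deg a_k ≤ u·(N-k)`, then for every absolute value `v`:
`v(α)^w ≤ (N·B)^w · max(v β, 1)^u` where `B = max(1, Σ_k ‖a_k‖₁)` (the local form of Bombieri–Gubler's
recursion bound (2.9) for powers of an integral generator whose minimal polynomial (2.5) has
weighted-homogeneous coefficients, here with general weights `(u, w)`). [cite: BombieriGubler2006, §2.5 (2.5)–(2.9) p.43] -/
theorem absValue_pow_le_of_weighted (v : AbsoluteValue K ℝ) {N u w : ℕ} (hN : 0 < N) (hw : 0 < w)
    (a : ℕ → ℤ[X]) (hd : ∀ k < N, w * (a k).natDegree ≤ u * (N - k)) {α β : K}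
    (hrel : α ^ N + ∑ k ∈ range N, aeval β (a k) * α ^ k = 0) :
    v α ^ w ≤ (N * max 1 (∑ k ∈ range N, ∑ i ∈ range ((a k).natDegree + 1), |((a k).coeff i : ℝ)|)) ^ w *
      max (v β) 1 ^ u := by
  set B : ℝ := max 1 (∑ k ∈ range N, ∑ i ∈ range ((a k).natDegree + 1), |((a k).coeff i : ℝ)|)
    with hB
  have hB1 : 1 ≤ B := le_max_left _ _
  have hBk : ∀ k ∈ range N, (∑ i ∈ range ((a k).natDegree + 1), |((a k).coeff i : ℝ)|) ≤ B :=
    fun k hk => (single_le_sum (fun j _ => l1norm_nonneg (a j)) hk).trans (le_max_right _ _)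
  set M : ℝ := max (v β) 1 with hM
  have hM1 : 1 ≤ M := le_max_right _ _
  refine pow_le_of_weighted_sum (v.nonneg α) hM1 hB1 hN hw hd ?_
  have h1 : α ^ N = -∑ k ∈ range N, aeval β (a k) * α ^ k := eq_neg_of_add_eq_zero_left hrel
  calc v α ^ N = v (∑ k ∈ range N, aeval β (a k) * α ^ k) := by
        rw [← map_pow, h1, v.map_neg]
    _ ≤ ∑ k ∈ range N, v (aeval β (a k) * α ^ k) := v.sum_le _ _
    _ ≤ ∑ k ∈ range N, B * M ^ (a k).natDegree * v α ^ k := sum_le_sum fun k hk => by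
        rw [map_mul, map_pow]
        have h2 := absValue_aeval_intPoly_le v (a k) β
        have h3 := hBk k hk
        have := v.nonneg (aeval β (a k))
        have := pow_nonneg (v.nonneg α) k
        have : 0 ≤ M ^ (a k).natDegree := by positivity
        calc v (aeval β (a k)) * v α ^ k
            ≤ ((∑ i ∈ range ((a k).natDegree + 1), |((a k).coeff i : ℝ)|) * M ^ (a k).natDegree) *
                v α ^ k := by gcongr
          _ ≤ B * M ^ (a k).natDegree * v α ^ k := by gcongr

/-- **Local weighted root bound** (non-archimedean type). Under the same hypotheses, for a
non-archimedean `v`: `v(α)^w ≤ max(v β, 1)^u` (no constant; the `δ_v = 0` case of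
Bombieri–Gubler (2.9)). [cite: BombieriGubler2006, §2.5 (2.5)–(2.9) p.43] -/
theorem absValue_pow_le_of_weighted_of_isNonarchimedean {v : AbsoluteValue K ℝ}
    (hv : IsNonarchimedean v) {N u w : ℕ} (hN : 0 < N) (hw : 0 < w) (a : ℕ → ℤ[X])
    (hd : ∀ k < N, w * (a k).natDegree ≤ u * (N - k)) {α β : K}
    (hrel : α ^ N + ∑ k ∈ range N, aeval β (a k) * α ^ k = 0) :
    v α ^ w ≤ max (v β) 1 ^ u := by
  set M : ℝ := max (v β) 1 with hM
  have hM1 : 1 ≤ M := le_max_right _ _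
  have hne : (range N).Nonempty := nonempty_range_iff.mpr hN.ne'
  have h1 : α ^ N = -∑ k ∈ range N, aeval β (a k) * α ^ k := eq_neg_of_add_eq_zero_left hrel
  have h2 : v α ^ N ≤ (range N).sup' hne fun k => v (aeval β (a k) * α ^ k) := by
    calc v α ^ N = v (∑ k ∈ range N, aeval β (a k) * α ^ k) := by rw [← map_pow, h1, v.map_neg]
      _ ≤ _ := hv.apply_sum_le_sup hne
  obtain ⟨k, hk, hk'⟩ := exists_mem_eq_sup' hne fun k => v (aeval β (a k) * α ^ k)
  rw [hk'] at h2
  refine pow_le_of_weighted_term (v.nonneg α) hM1 hw hd (mem_range.mp hk) (h2.trans ?_)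
  rw [map_mul, map_pow]
  have h3 := absValue_aeval_intPoly_le_of_isNonarchimedean hv (a k) β
  have := pow_nonneg (v.nonneg α) k
  gcongr

/-! ### The global bounds -/

variable [AdmissibleAbsValues K]

/-- **Weighted root height bound, multiplicative form.** If `α^N + Σ_{k<N} a_k(β) α^k = 0` with
`a_k ∈ ℤ[X]`, `0 < N`, `0 < w` and `w·deg a_k ≤ u·(N-k)` for all `k < N`, then
`H(α)^w ≤ ((N·B)^w)^{totalWeight K} · H(β)^u`, `B = max(1, Σ_k ‖a_k‖₁)` — the global (height)
form of Bombieri–Gubler §2.5's bounds (2.5)–(2.9) for an integral element over a polynomial ring with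
weighted-homogeneous minimal polynomial, in the affine two-variable case with general weights
`wt β = w`, `wt α = u`. [cite: BombieriGubler2006, §2.5 (2.5)–(2.9) p.43] -/
theorem mulHeight₁_pow_le_of_weighted {N u w : ℕ} (hN : 0 < N) (hw : 0 < w) (a : ℕ → ℤ[X])
    (hd : ∀ k < N, w * (a k).natDegree ≤ u * (N - k)) {α β : K}
    (hrel : α ^ N + ∑ k ∈ range N, aeval β (a k) * α ^ k = 0) :
    mulHeight₁ α ^ w ≤
      ((N * max 1 (∑ k ∈ range N, ∑ i ∈ range ((a k).natDegree + 1), |((a k).coeff i : ℝ)|)) ^ w)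
          ^ totalWeight K * mulHeight₁ β ^ u := by
  set B : ℝ := max 1 (∑ k ∈ range N, ∑ i ∈ range ((a k).natDegree + 1), |((a k).coeff i : ℝ)|)
    with hB
  have hB1 : 1 ≤ B := le_max_left _ _
  have hNB : (1 : ℝ) ≤ (N * B) ^ w := by
    have : (1 : ℝ) ≤ N := by exact_mod_cast hN
    exact one_le_pow₀ (by nlinarith)
  have hloc : ∀ v : AbsoluteValue K ℝ,
      ∏ i : Fin 1, max (v (![β] i)) 1 ^ ![u] i = max (v β) 1 ^ u := fun v => by
    rw [Fin.prod_univ_one]; rfl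
  have hglob : ∏ i : Fin 1, mulHeight₁ (![β] i) ^ ![u] i = mulHeight₁ β ^ u := by
    rw [Fin.prod_univ_one]; rfl
  have h := mulHeight₁_le_of_forall_absValue_le (K := K) (univ : Finset (Fin 1)) (y := α ^ w)
    (x := ![β]) (e := ![u]) (C := (N * B) ^ w) hNB (fun v _ => ?_) (fun v hv => ?_)
  · rw [hglob, mulHeight₁_pow] at h
    exact h
  · rw [hloc, map_pow]
    exact absValue_pow_le_of_weighted v hN hw a hd hrel
  · rw [hloc, map_pow]
    exact absValue_pow_le_of_weighted_of_isNonarchimedean (isNonarchimedean v hv) hN hw a hd hrel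

/-- **Weighted root height bound** (logarithmic form): under the hypotheses of
`mulHeight₁_pow_le_of_weighted`,
`w · logHeight₁ α ≤ u · logHeight₁ β + totalWeight K · (w · log (N·B))`, `B = max(1, Σ_k ‖a_k‖₁)`.
For a number field `totalWeight K = [K:ℚ]`, i.e. `w·h(α) ≤ u·h(β) + w·log(NB)` for the absolute
heights, uniformly in `K`. [cite: BombieriGubler2006, §2.5 (2.5)–(2.9) p.43] -/
theorem logHeight₁_le_of_weighted {N u w : ℕ} (hN : 0 < N) (hw : 0 < w) (a : ℕ → ℤ[X])
    (hd : ∀ k < N, w * (a k).natDegree ≤ u * (N - k)) {α β : K}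
    (hrel : α ^ N + ∑ k ∈ range N, aeval β (a k) * α ^ k = 0) :
    (w : ℝ) * logHeight₁ α ≤ u * logHeight₁ β + totalWeight K *
      (w * Real.log (N * max 1 (∑ k ∈ range N, ∑ i ∈ range ((a k).natDegree + 1), |((a k).coeff i : ℝ)|))) := by
  set B : ℝ := max 1 (∑ k ∈ range N, ∑ i ∈ range ((a k).natDegree + 1), |((a k).coeff i : ℝ)|)
    with hB
  have hB1 : 1 ≤ B := le_max_left _ _
  have hNB : (0 : ℝ) < N * B := by
    have : (0 : ℝ) < N := by exact_mod_cast hN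
    positivity
  have h := mulHeight₁_pow_le_of_weighted hN hw a hd hrel
  have hlog := Real.log_le_log (pow_pos (mulHeight₁_pos α) w) h
  rw [Real.log_pow, Real.log_mul (by positivity) (by positivity), Real.log_pow, Real.log_pow,
    Real.log_pow] at hlog
  simp only [logHeight₁_eq_log_mulHeight₁]
  have e : (w : ℝ) * ((totalWeight K : ℝ) * Real.log (N * B)) = totalWeight K * (w * Real.log (N * B)) := by
    ring
  linarith [hlog, e]

/-- **Weighted root height bound with an integer leading coefficient.** If
`c·α^N + Σ_{k<N} a_k(β) α^k = 0` with `c ∈ ℤ ∖ {0}`, `a_k ∈ ℤ[X]`, `0 < N`, `0 < w`,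
`w·deg a_k ≤ u·(N-k)`, then
`w · logHeight₁ α ≤ u · logHeight₁ β + totalWeight K · w · (log(N·B') + log |c|)`, where
`B' = max(1, Σ_k ‖c^{N-1-k} a_k‖₁)` (apply the monic case to `c·α`, a root of
`Y^N + Σ_k c^{N-1-k} a_k(β) Y^k`, and `h(α) ≤ h(cα) + h(c⁻¹)`). [cite: BombieriGubler2006, §2.5 (2.5)–(2.9) p.43] -/
theorem logHeight₁_le_of_weighted_leadingCoeff {N u w : ℕ} (hN : 0 < N) (hw : 0 < w) {c : ℤ}
    (hc : c ≠ 0) (a : ℕ → ℤ[X]) (hd : ∀ k < N, w * (a k).natDegree ≤ u * (N - k)) {α β : K}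
    [CharZero K]
    (hrel : (c : K) * α ^ N + ∑ k ∈ range N, aeval β (a k) * α ^ k = 0) :
    (w : ℝ) * logHeight₁ α ≤ u * logHeight₁ β + totalWeight K *
      (w * Real.log (N * max 1 (∑ k ∈ range N, ∑ i ∈ range ((C (c ^ (N - 1 - k)) * a k).natDegree + 1),
        |((C (c ^ (N - 1 - k)) * a k).coeff i : ℝ)|)) + w * Real.log |(c : ℝ)|) := by
  -- the rescaled relation for `c·α`
  set a' : ℕ → ℤ[X] := fun k => C (c ^ (N - 1 - k)) * a k with ha'
  have hd' : ∀ k < N, w * (a' k).natDegree ≤ u * (N - k) := fun k hk =>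
    (Nat.mul_le_mul_left w ((natDegree_C_mul_le _ _).trans le_rfl)).trans (hd k hk)
  have hcK : (c : K) ≠ 0 := by exact_mod_cast hc
  have hrel' : ((c : K) * α) ^ N + ∑ k ∈ range N, aeval β (a' k) * ((c : K) * α) ^ k = 0 := by
    have hmul := congrArg (fun z => (c : K) ^ (N - 1) * z) hrel
    simp only [mul_zero, mul_add, mul_sum] at hmul
    rw [← hmul]
    congr 1
    · rw [mul_pow, ← mul_assoc, ← pow_succ, Nat.sub_add_cancel hN]
    · refine sum_congr rfl fun k hk => ?_
      have hkN := mem_range.mp hk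
      rw [ha', map_mul, aeval_C, mul_pow, eq_intCast, Int.cast_pow]
      have : (c : K) ^ (N - 1) = (c : K) ^ (N - 1 - k) * (c : K) ^ k := by
        rw [← pow_add, Nat.sub_add_cancel (by omega)]
      rw [this]; ring
  have h := logHeight₁_le_of_weighted hN hw a' hd' hrel'
  -- `h(α) ≤ h(cα) + h(c)`
  have hsplit : logHeight₁ α ≤ logHeight₁ ((c : K) * α) + logHeight₁ (c : K) := by
    have e : α = (c : K)⁻¹ * ((c : K) * α) := by field_simp
    calc logHeight₁ α = logHeight₁ ((c : K)⁻¹ * ((c : K) * α)) := by rw [← e]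
      _ ≤ logHeight₁ (c : K)⁻¹ + logHeight₁ ((c : K) * α) := logHeight₁_mul_le _ _
      _ = logHeight₁ ((c : K) * α) + logHeight₁ (c : K) := by rw [logHeight₁_inv, add_comm]
  -- `h(c) ≤ totalWeight · log |c|`
  have hcnat : logHeight₁ (c : K) ≤ totalWeight K * Real.log |(c : ℝ)| := by
    have hn : c.natAbs ≠ 0 := Int.natAbs_ne_zero.mpr hc
    have h1 := mulHeight₁_natCast_le (K := K) c.natAbs hn
    have h2 : mulHeight₁ (c : K) = mulHeight₁ ((c.natAbs : ℕ) : K) := by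
      rcases Int.natAbs_eq c with h | h
      · conv_lhs => rw [h]
        simp
      · conv_lhs => rw [h]
        simp only [Int.cast_neg, Int.cast_natCast, mulHeight₁_neg]
    have hlog := Real.log_le_log (mulHeight₁_pos _) h1
    rw [Real.log_pow] at hlog
    rw [logHeight₁_eq_log_mulHeight₁, h2]
    have : ((c.natAbs : ℕ) : ℝ) = |(c : ℝ)| := by
      rw [Nat.cast_natAbs, Int.cast_abs]
    rw [← this]
    exact hlog
  have hw0 : (0 : ℝ) ≤ w := Nat.cast_nonneg _
  have h3 : (w : ℝ) * logHeight₁ α ≤ w * logHeight₁ ((c : K) * α) + w * logHeight₁ (c : K) := by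
    nlinarith [hsplit]
  have h4 : (w : ℝ) * logHeight₁ (c : K) ≤ totalWeight K * (w * Real.log |(c : ℝ)|) := by
    nlinarith [hcnat, Nat.cast_nonneg (α := ℝ) (totalWeight K)]
  linarith [h, h3, h4]

end WeightedRoot

end Literature.NumberTheory.DiophantineGeometry

end
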